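import Summits.Ventures.DiscreteObjects.Hadamard.ElemAbelian23Tools

/-!
# Hadamard 668 census, family F12 — no `C₂₃ × C₂₃` of signed automorphisms of an H(668) (kernel)

Framing: lottery ticket; floor = certified bounds/negative ranges.

Cell pub-namedobj (venture DiscreteObjects), target (H), hadamard gen 16.  **MAIN THEOREM of gen 16**
(`no_hadamard668_elemAbelian_rank2_23`): a Hadamard matrix of order `668` admits no two signed-permutation automorphisms
`(α, α', d₁, e₁)`, `(β, β', d₂, e₂)` with `α²³ = β²³ = α'²³ = β'²³ = 1`, commuting permutation parts, and `α, β`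
independent (`α^a β^b = 1`, `a, b < 23` ⇒ `a = b = 0`) — i.e. **no subgroup `C₂₃ × C₂₃` in the automorphism group**;
with `hadamard668_signedAut_not_dvd_orderOf_sq` (no element of order `529`): **`23² ∤ |Aut H|` for every H(668)**, and with
`ElemAbelianRank2Large668`: the Sylow `p`-subgroups of `Aut H(668)` are trivial or of prime order for every `p ≥ 13`.
PROOF (orthogonality, not only counting — Burnside alone is consistent here).  Every non-identity `g = (a,b)` has
`f(g) ∈ {1, 24}` fixed rows and as many fixed columns (census `hadamard668_signedAut_fixedRows`).  Burnside counting
(`exists_three_special_23`) gives special elements `g₀, h₁, h₂` (`f = 24`) on three distinct lines and a non-special `t`.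
`F := Fix_rows(g₀)` (24 rows) is not fixed pointwise by `h₁` or `h₂` (else, by `fixed_by_all_of_two_23`, by `t` too:
`f(t) ≥ 24`); hence `hᵢ` has exactly one fixed point in `F` (≡ 24 mod 23), the same point `x∞` for both (they commute),
and acts as a 23-cycle on `B := F ∖ {x∞}`.  Re-sign `H` so that `h₁` acts by pure permutations (`exists_resign_of_odd`);
then the row signs of `h₂` commute with `h₁` exactly (`signedAut_comm_of_odd`, odd exponent), so they are constant (`μ`)
on the `h₁`-cycle `B`, and every column fixed by `h₂'` carries column sign `μ` as well (23 odd).  Consequently each of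
the `24 + 24 − 1 = 47` columns fixed by `h₁'` or by `h₂'` (the two fixed 24-sets meet in one column, again by
`fixed_by_all_of_two_23` and a mod-23 count) is CONSTANT along the 23 rows of `B`; but pairwise orthogonal `±1` rows
that agree on `T` columns satisfy `|B|·|T| ≤ n` (`‖Σ_{x∈B} row_x‖² = |B| n`): `23 · 47 = 1081 > 668`.  Contradiction.
Ours, not literature (nearest print: Lander 1983 ch. 3, cyclic prime order); no `sorry`, no `native_decide`.
-/

namespace Summit.Ventures.DiscreteObjects.Hadamard

open Finset BigOperators

open Literature.Combinatorics.Designs.GoethalsSeidel (IsHadamardMatrix)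

variable {ι : Type*} [Fintype ι] [DecidableEq ι]

/-! ## The theorem -/

/-- **No `C₂₃ × C₂₃` of signed automorphisms of a Hadamard matrix of order 668.** -/
theorem no_hadamard668_elemAbelian_rank2_23 {H : Matrix ι ι ℤ} (hH : IsHadamardMatrix H)
    (hι : Fintype.card ι = 668) {α α' β β' : Equiv.Perm ι} {d₁ e₁ d₂ e₂ : ι → ℤ}
    (hA : IsSignedAut H α α' d₁ e₁) (hB : IsSignedAut H β β' d₂ e₂)
    (hα : α ^ 23 = 1) (hα' : α' ^ 23 = 1) (hβ : β ^ 23 = 1) (hβ' : β' ^ 23 = 1)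
    (hc : Commute α β) (hc' : Commute α' β')
    (hind : ∀ a b : ℕ, a < 23 → b < 23 → α ^ a * β ^ b = 1 → a = 0 ∧ b = 0) : False := by
  classical
  haveI : Fact (Nat.Prime 23) := ⟨by norm_num⟩
  -- the row and column permutations attached to g
  set σ : Multiplicative (ZMod 23 × ZMod 23) → Equiv.Perm ι :=
    fun g => α ^ (Multiplicative.toAdd g).1.val * β ^ (Multiplicative.toAdd g).2.val with hσ
  set σ' : Multiplicative (ZMod 23 × ZMod 23) → Equiv.Perm ι :=
    fun g => α' ^ (Multiplicative.toAdd g).1.val * β' ^ (Multiplicative.toAdd g).2.val with hσ'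
  have hσ23 : ∀ g, σ g ^ 23 = 1 := fun g => pairPerm_pow_p 23 α β hα hβ hc g
  have hσ'23 : ∀ g, σ' g ^ 23 = 1 := fun g => pairPerm_pow_p 23 α' β' hα' hβ' hc' g
  have hσne : ∀ g, g ≠ 1 → σ g ≠ 1 := fun g hg => pairPerm_ne_one 23 α β hind hg
  have hσcomm : ∀ g h, Commute (σ g) (σ h) := fun g h => pairPerm_commute 23 α β hα hβ hc g h
  have hσ'comm : ∀ g h, Commute (σ' g) (σ' h) := fun g h => pairPerm_commute 23 α' β' hα' hβ' hc' g h
  have haut : ∀ g, ∃ d e : ι → ℤ, IsSignedAut H (σ g) (σ' g) d e := fun g => isSignedAut_pair 23 hA hB g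
  -- fixed counts
  set f : Multiplicative (ZMod 23 × ZMod 23) → ℕ := fun g => (univ.filter fun i => σ g i = i).card with hf
  have hcensus : ∀ g, g ≠ 1 → (univ.filter fun j => σ' g j = j).card = f g ∧ (f g = 1 ∨ f g = 24) := by
    intro g hg
    obtain ⟨d, e, hg'⟩ := haut g
    exact census23 hH hι hg' (hσ23 g) (hσ'23 g) (hσne g hg)
  have hf1 : f 1 = 668 := by
    simp only [hf, hσ, toAdd_one, Prod.fst_zero, Prod.snd_zero, ZMod.val_zero, pow_zero, mul_one,
      Equiv.Perm.one_apply]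
    rw [Finset.filter_true_of_mem (fun _ _ => trivial), Finset.card_univ, hι]
  have hfpow : ∀ g, g ≠ 1 → ∀ k, k < 22 → f (g ^ (k + 1)) = f g := by
    intro g hg k hk
    simp only [hf]
    rw [show σ (g ^ (k + 1)) = σ g ^ (k + 1) from pairPerm_pow 23 α β hα hβ hc g (k + 1)]
    rw [fixed_pow_eq 23 (σ g) (hσ23 g) (by omega) (by omega)]
  have hdvd : 23 ^ 2 ∣ ∑ g, f g := sq_dvd_sum_card_fixed_pair 23 α β hα hβ hc
  obtain ⟨g₀, h₁, h₂, t, hg₀, hh₁, hh₂, ht, hfg₀, hfh₁, hfh₂, hft, hL01, hL02, hL12⟩ :=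
    exists_three_special_23 f hf1 (fun g hg => (hcensus g hg).2) hdvd hfpow
  -- F = fixed rows of g₀
  set F := univ.filter (fun i => σ g₀ i = i) with hF
  have hFcard : F.card = 24 := hfg₀
  have hFmem : ∀ i, i ∈ F ↔ σ g₀ i = i := fun i => by simp [hF]
  -- invariance of F under every σ g
  have hFinv : ∀ g i, i ∈ F ↔ σ g i ∈ F := by
    intro g i
    rw [hFmem, hFmem]
    have hcm : σ g₀ (σ g i) = σ g (σ g₀ i) := by
      have := congrArg (fun π => π i) (hσcomm g₀ g).eq
      simpa [Equiv.Perm.mul_apply] using this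
    rw [hcm]
    constructor
    · intro h; rw [h]
    · intro h; exact (σ g).injective h
  -- h₁, h₂ do not fix F pointwise (else t would)
  have hnotfix : ∀ h, h ≠ 1 → h ∉ (Finset.range 22).image (fun k => g₀ ^ (k + 1)) → ¬ (∀ i ∈ F, σ h i = i) := by
    intro h hh hhL hfix
    have hall := fixed_by_all_of_two_23 α β hα hβ hc F hg₀ hh hhL (fun i hi => (hFmem i).1 hi) hfix t
    have hsub : F ⊆ univ.filter (fun i => σ t i = i) := by
      intro i hi; simp only [Finset.mem_filter, Finset.mem_univ, true_and]; exact hall i hi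
    have := Finset.card_le_card hsub
    rw [hFcard] at this
    have hft' : (univ.filter (fun i => σ t i = i)).card = 1 := hft
    omega
  have hN1 := hnotfix h₁ hh₁ hL01
  have hN2 := hnotfix h₂ hh₂ hL02
  -- exactly one fixed point of h₁ (resp. h₂) in F
  have hone : ∀ h, h ≠ 1 → ¬ (∀ i ∈ F, σ h i = i) → (F.filter fun i => σ h i = i).card = 1 := by
    intro h hh hN
    have hmod := card_filter_fixed_mod_23 (σ h) (hσ23 h) F (hFinv h)
    rw [hFcard] at hmod
    have hle : (F.filter fun i => σ h i = i).card ≤ 24 := by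
      rw [← hFcard]; exact Finset.card_filter_le _ _
    have hne24 : (F.filter fun i => σ h i = i).card ≠ 24 := by
      intro h24
      apply hN
      have heq : (F.filter fun i => σ h i = i) = F :=
        Finset.eq_of_subset_of_card_le (Finset.filter_subset _ _) (by rw [hFcard, h24])
      intro i hi
      rw [← heq] at hi
      exact (Finset.mem_filter.mp hi).2
    omega
  obtain ⟨x₁, hx₁⟩ := Finset.card_eq_one.mp (hone h₁ hh₁ hN1)
  obtain ⟨x₂, hx₂⟩ := Finset.card_eq_one.mp (hone h₂ hh₂ hN2)
  have hx₁F : x₁ ∈ F ∧ σ h₁ x₁ = x₁ := by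
    have : x₁ ∈ F.filter (fun i => σ h₁ i = i) := by rw [hx₁]; exact Finset.mem_singleton_self _
    rw [Finset.mem_filter] at this
    exact ⟨this.1, this.2⟩
  have hx₂F : x₂ ∈ F ∧ σ h₂ x₂ = x₂ := by
    have : x₂ ∈ F.filter (fun i => σ h₂ i = i) := by rw [hx₂]; exact Finset.mem_singleton_self _
    rw [Finset.mem_filter] at this
    exact ⟨this.1, this.2⟩
  -- the two fixed points coincide
  have hx12 : x₁ = x₂ := by
    have hmem : σ h₂ x₁ ∈ F.filter (fun i => σ h₁ i = i) := by
      rw [Finset.mem_filter]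
      refine ⟨(hFinv h₂ x₁).1 hx₁F.1, ?_⟩
      have := congrArg (fun π => π x₁) (hσcomm h₁ h₂).eq
      simp only [Equiv.Perm.mul_apply] at this
      rw [this, hx₁F.2]
    rw [hx₁, Finset.mem_singleton] at hmem
    have : x₁ ∈ F.filter (fun i => σ h₂ i = i) := Finset.mem_filter.mpr ⟨hx₁F.1, hmem⟩
    rw [hx₂, Finset.mem_singleton] at this
    exact this
  -- B = F minus the common fixed point
  set B := F.erase x₁ with hBdef
  have hBcard : B.card = 23 := by rw [hBdef, Finset.card_erase_of_mem hx₁F.1, hFcard]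
  have hBinv : ∀ h, h ≠ 1 → (F.filter fun i => σ h i = i) = {x₁} → ∀ x ∈ B, σ h x ∈ B := by
    intro h hh hfix x hx
    rw [hBdef, Finset.mem_erase] at hx ⊢
    have hxfix : σ h x₁ = x₁ := by
      have : x₁ ∈ F.filter (fun i => σ h i = i) := by rw [hfix]; exact Finset.mem_singleton_self _
      exact (Finset.mem_filter.mp this).2
    refine ⟨fun heq => hx.1 ((σ h).injective (heq.trans hxfix.symm)), (hFinv h x).1 hx.2⟩
  have hBfpf : ∀ h, (F.filter fun i => σ h i = i) = {x₁} → ∀ x ∈ B, σ h x ≠ x := by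
    intro h hfix x hx heq
    rw [hBdef, Finset.mem_erase] at hx
    have : x ∈ F.filter (fun i => σ h i = i) := Finset.mem_filter.mpr ⟨hx.2, heq⟩
    rw [hfix, Finset.mem_singleton] at this
    exact hx.1 this
  have hx₂' : (F.filter fun i => σ h₂ i = i) = {x₁} := by rw [hx₂, hx12]
  have hB1inv := hBinv h₁ hh₁ hx₁
  have hB2inv := hBinv h₂ hh₂ hx₂'
  have hB1fpf := hBfpf h₁ hx₁
  have hB2fpf := hBfpf h₂ hx₂'
  -- a base point of B
  have hBne : B.Nonempty := by rw [← Finset.card_pos, hBcard]; norm_num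
  obtain ⟨x₀, hx₀⟩ := hBne
  -- re-sign with respect to h₁
  obtain ⟨dh1, eh1, hS1⟩ := haut h₁
  obtain ⟨s, t', hs, ht', hH1, hinv1⟩ := exists_resign_of_odd hH hS1 (by decide : Odd 23) (hσ23 h₁) (hσ'23 h₁)
  set H₁ : Matrix ι ι ℤ := Matrix.of fun i j => s i * t' j * H i j with hH₁def
  have hH1aut : ∀ i j, H₁ (σ h₁ i) (σ' h₁ j) = H₁ i j := by
    intro i j; simp only [hH₁def, Matrix.of_apply]; exact hinv1 i j
  have hH1ne : ∀ i j, H₁ i j ≠ 0 := fun i j => pm_ne_zero (hH1.1 i j)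
  -- h₂ as a signed automorphism of H₁
  obtain ⟨d2, e2, hS2⟩ := haut h₂
  have hS2' : IsSignedAut H₁ (σ h₂) (σ' h₂) (fun i => s (σ h₂ i) * d2 i * s i)
      (fun j => t' (σ' h₂ j) * e2 j * t' j) := by
    refine ⟨fun i => ?_, fun j => ?_, fun i j => ?_⟩
    · rcases hs (σ h₂ i) with h | h <;> rcases hS2.1 i with h' | h' <;> rcases hs i with h'' | h'' <;>
        simp [h, h', h'']
    · rcases ht' (σ' h₂ j) with h | h <;> rcases hS2.2.1 j with h' | h' <;> rcases ht' j with h'' | h'' <;>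
        simp [h, h', h'']
    · simp only [hH₁def, Matrix.of_apply]
      rw [hS2.2.2 i j]
      have hsi : s i * s i = 1 := pm_mul_self (hs i)
      have htj : t' j * t' j = 1 := pm_mul_self (ht' j)
      calc s (σ h₂ i) * t' (σ' h₂ j) * (d2 i * e2 j * H i j)
          = s (σ h₂ i) * t' (σ' h₂ j) * (d2 i * e2 j * H i j) * ((s i * s i) * (t' j * t' j)) := by
            rw [hsi, htj, mul_one, mul_one]
        _ = s (σ h₂ i) * d2 i * s i * (t' (σ' h₂ j) * e2 j * t' j) * (s i * t' j * H i j) := by ring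
  have hS1' : IsSignedAut H₁ (σ h₁) (σ' h₁) (fun _ => 1) (fun _ => 1) :=
    ⟨fun _ => Or.inl rfl, fun _ => Or.inl rfl, fun i j => by rw [hH1aut i j]; ring⟩
  haveI : Nonempty ι := ⟨x₀⟩
  obtain ⟨hdcomm, hecomm⟩ := signedAut_comm_of_odd hH1ne hS1' hS2' (hσcomm h₁ h₂) (hσ'comm h₁ h₂)
    (by decide : Odd 23) (hσ23 h₂) (hσ'23 h₂)
  -- the row sign of h₂ (on H₁) is constant μ on B
  set d2' : ι → ℤ := fun i => s (σ h₂ i) * d2 i * s i with hd2'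
  set e2' : ι → ℤ := fun j => t' (σ' h₂ j) * e2 j * t' j with he2'
  have hd2'step : ∀ x ∈ B, d2' (σ h₁ x) = d2' x := by
    intro x _; have := hdcomm x; simpa using this.symm
  have hμ : ∀ x ∈ B, d2' x = d2' x₀ := by
    intro x hx
    obtain ⟨k, hk⟩ := exists_pow_apply_eq_23 (σ h₁) (hσ23 h₁) B hBcard hB1inv hB1fpf hx₀ hx
    rw [← hk]
    exact apply_pow_eq_of_step (σ h₁) B hB1inv d2' hd2'step hx₀ k
  -- columns fixed by h₂': column sign = μ, hence constant along B
  have hcol2 : ∀ y, σ' h₂ y = y → ∀ x ∈ B, H₁ (σ h₂ x) y = H₁ x y := by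
    intro y hy x hx
    have hrel := hS2'.2.2 x y
    rw [hy] at hrel
    -- e2' y = μ : from the 23-step cycle product at x₀
    have hprod := signedAut_pow hS2' 23 x₀ y
    rw [hσ23 h₂, hσ'23 h₂, Equiv.Perm.one_apply, Equiv.Perm.one_apply] at hprod
    have hcycE : cyc (σ' h₂) e2' y 23 = e2' y := by
      unfold cyc
      have hfixpow : ∀ l : ℕ, (σ' h₂ ^ l) y = y := by
        intro l; induction l with
        | zero => simp
        | succ l ih => rw [pow_succ', Equiv.Perm.mul_apply, ih, hy]
      rw [Finset.prod_congr rfl (fun l _ => by rw [hfixpow l]), Finset.prod_const, Finset.card_range]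
      exact pm_pow_23 (hS2'.2.1 y)
    have hcycD : cyc (σ h₂) d2' x₀ 23 = d2' x₀ := by
      unfold cyc
      have hmemB : ∀ l : ℕ, (σ h₂ ^ l) x₀ ∈ B := by
        intro l; induction l with
        | zero => simpa using hx₀
        | succ l ih => rw [pow_succ', Equiv.Perm.mul_apply]; exact hB2inv _ ih
      rw [Finset.prod_congr rfl (fun l _ => hμ _ (hmemB l)), Finset.prod_const, Finset.card_range]
      exact pm_pow_23 (hS2'.1 x₀)
    have hDE : cyc (σ h₂) d2' x₀ 23 * cyc (σ' h₂) e2' y 23 = 1 := by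
      have hne := hH1ne x₀ y
      have : (cyc (σ h₂) d2' x₀ 23 * cyc (σ' h₂) e2' y 23 - 1) * H₁ x₀ y = 0 := by
        have := hprod; simp only [hd2', he2'] at this ⊢; linarith
      rcases mul_eq_zero.mp this with h0 | h0
      · linarith
      · exact absurd h0 hne
    rw [hcycE, hcycD] at hDE
    -- so d2' x * e2' y = μ * μ⁻¹... : d2' x = μ and e2' y = μ
    have hμx := hμ x hx
    have hμμ : d2' x₀ * d2' x₀ = 1 := pm_mul_self (hS2'.1 x₀)
    have he2y : e2' y = d2' x₀ := by
      calc e2' y = (d2' x₀ * d2' x₀) * e2' y := by rw [hμμ, one_mul]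
        _ = d2' x₀ * (d2' x₀ * e2' y) := by ring
        _ = d2' x₀ := by rw [hDE, mul_one]
    rw [hrel]
    show d2' x * e2' y * H₁ x y = H₁ x y
    rw [hμx, he2y, hμμ, one_mul]
  -- columns fixed by h₁' are constant along B (h₁ unsigned on H₁)
  have hcol1 : ∀ y, σ' h₁ y = y → ∀ x ∈ B, H₁ (σ h₁ x) y = H₁ x y := by
    intro y hy x _
    have := hH1aut x y
    rw [hy] at this
    exact this
  -- the set of constant columns
  set F' := univ.filter (fun j => σ' h₁ j = j) with hF'
  set F'' := univ.filter (fun j => σ' h₂ j = j) with hF''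
  have hF'card : F'.card = 24 := by rw [hF', (hcensus h₁ hh₁).1]; exact hfh₁
  have hF''card : F''.card = 24 := by rw [hF'', (hcensus h₂ hh₂).1]; exact hfh₂
  have hconst : ∀ y ∈ F' ∪ F'', ∀ x ∈ B, H₁ x y = H₁ x₀ y := by
    intro y hy x hx
    rw [Finset.mem_union] at hy
    rcases hy with hy | hy
    · have hy' : σ' h₁ y = y := by simpa [hF'] using hy
      obtain ⟨k, hk⟩ := exists_pow_apply_eq_23 (σ h₁) (hσ23 h₁) B hBcard hB1inv hB1fpf hx₀ hx
      rw [← hk]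
      exact apply_pow_eq_of_step (σ h₁) B hB1inv (fun x => H₁ x y) (fun x hx => hcol1 y hy' x hx) hx₀ k
    · have hy' : σ' h₂ y = y := by simpa [hF''] using hy
      obtain ⟨k, hk⟩ := exists_pow_apply_eq_23 (σ h₂) (hσ23 h₂) B hBcard hB2inv hB2fpf hx₀ hx
      rw [← hk]
      exact apply_pow_eq_of_step (σ h₂) B hB2inv (fun x => H₁ x y) (fun x hx => hcol2 y hy' x hx) hx₀ k
  -- |F' ∩ F''| = 1 : F' is σ' h₂-invariant, not fixed pointwise, fixed points ≡ 24 (mod 23)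
  have hF'inv : ∀ j, j ∈ F' ↔ σ' h₂ j ∈ F' := by
    intro j
    simp only [hF', Finset.mem_filter, Finset.mem_univ, true_and]
    have hcm : σ' h₁ (σ' h₂ j) = σ' h₂ (σ' h₁ j) := by
      have := congrArg (fun π => π j) (hσ'comm h₁ h₂).eq
      simpa [Equiv.Perm.mul_apply] using this
    rw [hcm]
    constructor
    · intro h; rw [h]
    · intro h; exact (σ' h₂).injective h
  have hN3 : ¬ (∀ j ∈ F', σ' h₂ j = j) := by
    intro hfix
    have hall := fixed_by_all_of_two_23 α' β' hα' hβ' hc' F' hh₁ hh₂ hL12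
      (fun j hj => (Finset.mem_filter.mp hj).2) hfix t
    have hsub : F' ⊆ univ.filter (fun j => σ' t j = j) := by
      intro j hj; simp only [Finset.mem_filter, Finset.mem_univ, true_and]; exact hall j hj
    have := Finset.card_le_card hsub
    rw [hF'card, (hcensus t ht).1] at this
    have hft' : f t = 1 := hft
    omega
  have hinter : (F' ∩ F'').card = 1 := by
    have heq : F' ∩ F'' = F'.filter (fun j => σ' h₂ j = j) := by
      ext j; simp [hF', hF'', Finset.mem_filter, Finset.mem_inter]
    rw [heq]
    have hmod := card_filter_fixed_mod_23 (σ' h₂) (hσ'23 h₂) F' hF'inv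
    rw [hF'card] at hmod
    have hle : (F'.filter fun j => σ' h₂ j = j).card ≤ 24 := by
      rw [← hF'card]; exact Finset.card_filter_le _ _
    have hne24 : (F'.filter fun j => σ' h₂ j = j).card ≠ 24 := by
      intro h24
      apply hN3
      have heq' : (F'.filter fun j => σ' h₂ j = j) = F' :=
        Finset.eq_of_subset_of_card_le (Finset.filter_subset _ _) (by rw [hF'card, h24])
      intro j hj
      rw [← heq'] at hj
      exact (Finset.mem_filter.mp hj).2
    omega
  have hTcard : (F' ∪ F'').card = 47 := by
    have := Finset.card_union_add_card_inter F' F''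
    rw [hF'card, hF''card, hinter] at this
    omega
  -- orthogonality bound: 23 · 47 ≤ 668, absurd
  have hbound := card_mul_card_le_of_const_cols hH1 B (F' ∪ F'') x₀ hx₀ hconst
  rw [hBcard, hTcard, hι] at hbound
  norm_num at hbound

end Summit.Ventures.DiscreteObjects.Hadamard
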